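import Summits.BirchSwinnertonDyer.BirchSwinnertonDyer.Theorems.ByReductionTypeAtTwoOrdKatoHalfAtTwoIsoSignFreeDefs
import Summits.BirchSwinnertonDyer.BirchSwinnertonDyer.Theorems.ByReductionTypeAtTwoOrdKatoHalfAtTwoIsoPosDiscSplit
import Summits.BirchSwinnertonDyer.BirchSwinnertonDyer.Theses.ByReductionTypeAtTwo
import HarnessLib

/-!
# Route ByReductionTypeAtTwo (K4): the split glue `OrdKatoHalfAtTwoIsoOfChildren` of crux 202 closed BY NAME

Seat `cruxlead-stmt-BirchSwinnertonDyer-19573` (LEAD PROVER, MODE LINE, line `steinberg-fibre-at-two`; HOME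
`run/shared/lean/pub/bsd-2adic/`; pen package P2″ «split of `OrdKatoHalfAtTwoIso`», RC-347, director (295)(b)). HONEST
FRAMING (cell bsd-2adic): BSD is not proved by any of this and the crux `OrdKatoHalfAtTwoIso` (stmt-BirchSwinnertonDyer-19573)
is NOT proved here — this file proves only the GENERATED SPLIT GLUE «the print bundle and the three beyond-print children
imply the parent», by ONE application of the landed conditional closing theorem
`SteinbergFibreAtTwo.ordKatoHalfAtTwoIso_of_memo_cite` (p669276: door p655368 ∘ Ω-road composition p658966 ∘ T1 p663770 /
H-C p662346 / H-K p668150). The children stay OPEN items / named facts: `OrdKatoIsoPrintBundleAtTwo`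
(`Literature.Uncategorized.OrdPublishedInputsAtTwo ∧` Abbes–Ullmo 1996 Thm A by name), `OrdKatoFineZetaAtTwoResidue` (MEMO-5′
reading, verbatim `SteinbergFibreAtTwo.DivisibilityInputsFineZetaAtTwoResidue`), `OrdKatoMuPartOptimalAtTwo` (MEMO-7),
`OrdKatoIntSurjectiveAtTwo` (W_K2 + MEMO-6). Nothing else is asserted.

MEANING-ROBUST PROOF (lead g4, pen RC-353 (1) / RC-358 «P5 (ii)»): the proof is a `first | exact … | …` block whose
branches are the landed doors for the CURRENT child texts and for each re-typing the pen has packaged or the lead has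
certified — F1μ re-cut of child 23760 (`…_of_zetaColemanMu_cite`, p678187), the print bundle 23759 enlarged by Greenberg's
Prop. 5.14 at `2`, the B7 re-cut of child 23780 off the 5.14 locus (`…_of_recut_cite`, p679274), B8 narrowed to
`Δ_W > 0` (`…_of_zetaColemanMu_posDisc` p678698 / `…_of_recut` p679274). Exactly one branch elaborates at any route
revision (today: the first); the statement `OrdKatoHalfAtTwoIsoOfChildren` is unchanged, so item 23763 stays closed
across the restates and the tree stays green. Dead branches are removed in a follow-up once the texts settle.

LEAD g5 (after the pen's P5′ = K4 rev 32–36, and for P7 «sign-free re-cut», pen RC-366): the branches that can no longer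
fire (two-conjunct bundle, F1⁽²⁾ text, B8 narrowed to `Δ > 0`) are REMOVED, and two P7 branches are ADDED over the named
sign-free binders of `…OrdKatoHalfAtTwoIsoSignFreeDefs.lean` — F1 slot := F1μ⁺ `ZetaColemanMuInputsAtTwo` with the filed B8
(`…_of_recut_cite` ∘ monotonicity F1μ⁺ ⇒ F1μ), and F1 slot := F1μ⁺ with the B8 slot := CoreA⁺ `CoreTheoremAPosDiscTwo`
(`…_of_signFree_cite`; B8 then DERIVED, not assumed). Live today (rev 36: bundle = PUB ∧ AU ∧ 5.14, F1μ, B7′, B8): the first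
branch. The statement is unchanged.
-/

set_option linter.dupNamespace false
-- all but one branch of the `first` block below are dead at any given route revision (by design)
set_option linter.unusedTactic false
set_option linter.unreachableTactic false

namespace Summit.BirchSwinnertonDyer.BirchSwinnertonDyer.Theorems

open Summit.BirchSwinnertonDyer.BirchSwinnertonDyer.Theses.ByReductionTypeAtTwo

/-- **K4 split glue `OrdKatoHalfAtTwoIsoOfChildren` (route `ByReductionTypeAtTwo`, parent crux 202 `OrdKatoHalfAtTwoIso`),
proved by name:** `OrdKatoIsoPrintBundleAtTwo → OrdKatoFineZetaAtTwoResidue → OrdKatoMuPartOptimalAtTwo →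
OrdKatoIntSurjectiveAtTwo → OrdKatoHalfAtTwoIso` — one application of `SteinbergFibreAtTwo.ordKatoHalfAtTwoIso_of_memo_cite`
(p669276); the child texts unfold definitionally to that theorem's hypotheses (`OrdKatoFineZetaAtTwoResidue` is VERBATIM
the body of `SteinbergFibreAtTwo.DivisibilityInputsFineZetaAtTwoResidue`; the bundle's first conjunct is the Literature
constant behind the route's `OrdPublishedInputsAtTwo`). Meaning-robust (P5 (ii)): before the F1μ restate of child 23760
the first branch (p669276) fires; after it the `…_of_zetaColemanMu_cite` branch (p678187); after the B7 re-cut / bundle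
enlargement the `…_of_recut_cite` branch (p679274); after the P7 sign-free re-cut (lead g5) the `…_of_signFree_cite`
branch with B8 DERIVED; after P8′ (F1 ↦ F1μι⁻ on `Δ < 0`, new DIRECT `0 < Δ` child) the lead's
`…_of_iota_halves` branches. BSD is not proved; the parent crux stays conditional on its open children. [folklore] -/
theorem ordKatoHalfAtTwoIsoOfChildren_proof : OrdKatoHalfAtTwoIsoOfChildren := by
  first
  -- P8′ AS PACKAGED (pen RC-390 (2) / RC-393: PAIR-IN-THE-F1-SLOT, glue statement unchanged): bundle3,
  -- F1 := «F1μι⁻ ∧ PosDisc» (bodies of `ZetaColemanMuIotaNegDiscAtTwo` ∧ `OrdKatoHalfAtTwoIsoPosDisc` verbatim), B7′, core⁺ (unused)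
  | exact fun hB hF1 hB7 hB8 => SteinbergFibreAtTwo.ordKatoHalfAtTwoIso_of_iota_halves hF1.1 hF1.2 hB hB7
  -- P8′ (pen RC-388/389; lead `RELINE-posDisc.md`): bundle3, F1μι⁻ (`ZetaColemanMuIotaNegDiscAtTwo`), B7′, [CoreA⁺ kept or dropped],
  -- NEW child «the 0 < Δ cell, DIRECT» (`OrdKatoHalfAtTwoIsoPosDisc`) — the lead's split-glue door `…_of_iota_halves`; dead before P8′
  | exact fun hB hF1 hB7 hB8 hPos => SteinbergFibreAtTwo.ordKatoHalfAtTwoIso_of_iota_halves hF1 hPos hB hB7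
  | exact fun hB hF1 hB7 hPos hB8 => SteinbergFibreAtTwo.ordKatoHalfAtTwoIso_of_iota_halves hF1 hPos hB hB7
  | exact fun hB hF1 hPos hB7 hB8 => SteinbergFibreAtTwo.ordKatoHalfAtTwoIso_of_iota_halves hF1 hPos hB hB7
  | exact fun hB hF1 hB7 hPos => SteinbergFibreAtTwo.ordKatoHalfAtTwoIso_of_iota_halves hF1 hPos hB hB7
  -- rev 36 (P5′ done): bundle = PUB ∧ AU ∧ Prop 5.14@2, F1μ, B7′ re-cut off the 5.14 locus, B8
  | exact fun hB hF1 hB7 hB8 =>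
      SteinbergFibreAtTwo.ordKatoHalfAtTwoIso_of_recut_cite hF1 hB.2.1 hB.2.2 hB7 hB8 hB.1
  -- rev 32–35: bundle = PUB ∧ AU ∧ Prop 5.14@2, F1μ, filed B7, B8
  | exact fun hB hF1 hB7 hB8 => SteinbergFibreAtTwo.ordKatoHalfAtTwoIso_of_zetaColemanMu_cite hF1 hB.2.1 hB7 hB8 hB.1
  -- P7 step F1 only (lead g5): bundle3, F1μ⁺ sign-free, B7′, filed B8 — monotonicity F1μ⁺ ⇒ F1μ, then the rev-36 door
  | exact fun hB hF1 hB7 hB8 =>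
      SteinbergFibreAtTwo.ordKatoHalfAtTwoIso_of_recut_cite
        (SteinbergFibreAtTwo.zetaColemanMuInputsNegDiscAtTwo_of_zetaColemanMuInputsAtTwo hF1) hB.2.1 hB.2.2 hB7 hB8 hB.1
  -- P7 complete (lead g5): bundle3, F1μ⁺ sign-free, B7′, B8 slot := CoreA⁺ on 0 < Δ (the real place) — B8 derived inside
  | exact fun hB hF1 hB7 hB8 => SteinbergFibreAtTwo.ordKatoHalfAtTwoIso_of_signFree_cite hF1 hB8 hB hB7
  -- P7 complete with the filed B7 in the B7 slot (insurance)
  | exact fun hB hF1 hB7 hB8 => SteinbergFibreAtTwo.ordKatoHalfAtTwoIso_of_signFree_cite_B7 hF1 hB8 hB hB7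

end Summit.BirchSwinnertonDyer.BirchSwinnertonDyer.Theorems
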